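import Literature.Probability.RandomPlanarGeometry.SAWCountMonotoneFractional
import HarnessLib

/-!
# Monotonicity `cₙ ≤ cₙ₊₁` (O'Brien 1990): the DEGREE form of the certificate — many repair images per
# doubly trapped walk, few doubly trapped preimages per image

Sequel of `SAWCountMonotoneFractional.lean` (`count_le_count_succ_of_fractional`: `cₙ ≤ cₙ₊₁` from any
fractional mass distribution of the doubly trapped walks within the spare capacities).  Spreading each
doubly trapped walk UNIFORMLY over a set of images gives the simplest certificate of that kind, a double
counting of Hall type: if every doubly trapped `n`-step walk `ω` has at least `D ≥ 1` admissible images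
(`n`-step self-avoiding walks `ω'` in a relation `R ω ω'`), and every `n`-step walk `ω'` is an admissible
image of at most `D · (extCount ω' n - 2)` doubly trapped walks (or `D · (extCount ω' n - 1)` when its
start is not completely surrounded), then `cₙ ≤ cₙ₊₁`.  On `ℤ²`, with the retract-fold images of
`SAWCountMonotoneMast.lean` (masts `≤ 3` at every extreme visit), exact enumeration gives minimum
out-degree `24, 21, 21, 19, 19, 16, 12` against maximum in-degree/capacity `2, 4, 5, 6, 7, 8, 9` for
`n = 14, …, 20` (lane note `OBRIEN-DESIGN-2.md` §7; the margin shrinks with the mast length fixed, so in an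
all-`n` argument the admissible mast length must grow with `n`) — this is the shape in which an all-`n`
proof is sought: a LOWER bound on the images of a doubly trapped walk and an UPPER bound on the doubly
trapped preimages of a walk.

* `count_le_count_succ_of_degree` : the statement above.

[cite: MadrasSlade1993, §1.1, §7.1] [cite: BDGS2012, §1.3 (`cₙ ≤ cₙ₊₁`, O'Brien 1990)]
-/

noncomputable section

open Literature.Probability.LatticeModels Literature.Probability.Percolation SimpleGraph
open scoped BigOperators

namespace Literature.Probability.RandomPlanarGeometry.SAW.Zd

variable {d : ℕ}

open Classical in
/-- **Degree (Hall-type) certificate for O'Brien's inequality.** Let `R` relate `n`-step walks and let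
`D ≥ 1`. If every doubly trapped walk is `R`-related to at least `D` walks of `saws d n`, and every
`ω' ∈ saws d n` is `R`-related from at most `D · (extCount ω' n - 2)` doubly trapped walks — or from at
most `D · (extCount ω' n - 1)` of them when `extCount (revWalk n ω') n ≥ 1` — then `cₙ ≤ cₙ₊₁`.
(Uniform masses `1 / #images` in `count_le_count_succ_of_fractional`.) [cite: BDGS2012, §1.3] -/
theorem count_le_count_succ_of_degree {n : ℕ} (R : (ℕ → Site d) → (ℕ → Site d) → Prop) (D : ℕ)
    (hD : 1 ≤ D)
    (hout : ∀ ω ∈ doublyTrapped d n, D ≤ ((saws d n).filter fun ω' => R ω ω').card)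
    (hin : ∀ ω' ∈ saws d n,
      ((doublyTrapped d n).filter fun ω => R ω ω').card = 0 ∨
      ((doublyTrapped d n).filter fun ω => R ω ω').card + 2 * D ≤ D * extCount ω' n ∨
      (((doublyTrapped d n).filter fun ω => R ω ω').card + D ≤ D * extCount ω' n ∧
        1 ≤ extCount (revWalk n ω') n)) :
    count d n ≤ count d (n + 1) := by
  classical
  -- uniform masses over the images inside `saws d n`
  set deg : (ℕ → Site d) → ℕ := fun ω => ((saws d n).filter fun ω' => R ω ω').card with hdeg
  set W : (ℕ → Site d) → (ℕ → Site d) → ℚ :=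
    fun ω ω' => if ω' ∈ saws d n ∧ R ω ω' then (1 : ℚ) / deg ω else 0 with hW
  have hDq : (0 : ℚ) < D := by exact_mod_cast hD
  refine count_le_count_succ_of_fractional W (fun ω ω' => ?_) (fun ω hω => ?_) (fun ω' hω' => ?_)
  · simp only [hW]; split_ifs <;> positivity
  · -- row sums: `deg ω` images, each of mass `1 / deg ω`
    have hpos : 0 < deg ω := lt_of_lt_of_le (by omega) (hout ω hω)
    have : ∑ ω' ∈ saws d n, W ω ω' = ∑ ω' ∈ (saws d n).filter (fun ω' => R ω ω'), (1 : ℚ) / deg ω := by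
      rw [Finset.sum_filter]
      refine Finset.sum_congr rfl fun ω' hω' => ?_
      simp only [hW, hω', true_and]
    rw [this, Finset.sum_const, nsmul_eq_mul]
    have hq : (deg ω : ℚ) ≠ 0 := by exact_mod_cast hpos.ne'
    field_simp
    rfl
  · -- column sums: `≤ (in-degree) / D`
    set m := ((doublyTrapped d n).filter fun ω => R ω ω').card with hm
    have hcol : ∑ ω ∈ doublyTrapped d n, W ω ω' ≤ (m : ℚ) / D := by
      have h1 : ∑ ω ∈ doublyTrapped d n, W ω ω' =
          ∑ ω ∈ (doublyTrapped d n).filter (fun ω => R ω ω'), (1 : ℚ) / deg ω := by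
        rw [Finset.sum_filter]
        refine Finset.sum_congr rfl fun ω hω => ?_
        simp only [hW, hω', true_and]
      rw [h1]
      have h2 : ∀ ω ∈ (doublyTrapped d n).filter (fun ω => R ω ω'), (1 : ℚ) / deg ω ≤ 1 / D := by
        intro ω hω
        have hωT := (Finset.mem_filter.1 hω).1
        have : (D : ℚ) ≤ deg ω := by exact_mod_cast hout ω hωT
        exact one_div_le_one_div_of_le hDq this
      calc ∑ ω ∈ (doublyTrapped d n).filter (fun ω => R ω ω'), (1 : ℚ) / deg ω
          ≤ ∑ ω ∈ (doublyTrapped d n).filter (fun ω => R ω ω'), (1 : ℚ) / D := Finset.sum_le_sum h2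
        _ = (m : ℚ) / D := by rw [Finset.sum_const, nsmul_eq_mul, hm]; ring
    have hnonneg : (0 : ℚ) ≤ ∑ ω ∈ doublyTrapped d n, W ω ω' :=
      Finset.sum_nonneg fun ω _ => by simp only [hW]; split_ifs <;> positivity
    rcases hin ω' hω' with h | h | ⟨h, hrev⟩
    · left
      have : (m : ℚ) = 0 := by exact_mod_cast h
      rw [this, zero_div] at hcol
      linarith
    · right; left
      have h' : (m : ℚ) + 2 * D ≤ D * extCount ω' n := by exact_mod_cast h
      have : (m : ℚ) / D + 2 ≤ extCount ω' n := by
        rw [div_add' _ _ _ hDq.ne', div_le_iff₀ hDq]; linarith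
      linarith
    · right; right
      refine ⟨?_, hrev⟩
      have h' : (m : ℚ) + D ≤ D * extCount ω' n := by exact_mod_cast h
      have : (m : ℚ) / D + 1 ≤ extCount ω' n := by
        rw [div_add' _ _ _ hDq.ne', div_le_iff₀ hDq]; linarith
      linarith

end Literature.Probability.RandomPlanarGeometry.SAW.Zd
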